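import Summits.HubbardSuperconductivity.HubbardSuperconductivity.Theorems.JosephsonMirrorWindowDouble
import Literature.MathematicalPhysics.QuantumLattice.LiebSpinReflection
import Literature.MathematicalPhysics.QuantumLattice.SectorSpectrum

/-!
# Route `JosephsonMirror` — the mirror symmetry of the window double

Helper file for support item stmt-HubbardSuperconductivity-2230 (`JmPositiveMinimiser`) of route
`JosephsonMirror` (sub-problem `HubbardSuperconductivity`). In Lieb's `W`-matrix packaging
`ψ_W(s,t) = W_{st}` the window double `H(J) = A ⊗ 1 + 1 ⊗ Aᵀ - J (D ⊗ D̄ + Dᴴ ⊗ D̄ᴴ)` acts as the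
matrix map `𝓛 W = A W + W A - J (D W Dᴴ + Dᴴ W D)` (`kronecker_mulVec_vec`, `windowOp`), the
inner product is Hilbert–Schmidt (`star_vec_dotProduct_vec`), and `(𝓛 W)ᴴ = 𝓛 Wᴴ` for Hermitian
`A`: the antiunitary MIRROR `ψ_W ↦ ψ_{Wᴴ}` (layer swap ∘ complex conjugation) commutes with `H(J)`
for ANY Hermitian `A` and ANY `D`. Consequence (`exists_hermitian_window_groundMatrix`): on a
mirror-symmetric coordinate window `S` the compression of `H(J)` has a ground vector `ψ_W` with
`W` HERMITIAN, nonzero, supported in the window, of energy `E(J) ‖W‖²`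
(`E(J) = minEnergyOn (H(J)) S`; from any ground vector `ψ_W` take `W + Wᴴ` or `i (W - Wᴴ)`).

Sources: E. H. Lieb, Phys. Rev. Lett. 62 (1989) 1201, proof of Theorem 1 (the `W`-matrix method,
"`W` can be taken Hermitian"); F. J. Dyson, E. H. Lieb, B. Simon, J. Stat. Phys. 18 (1978) 335
(reflection positivity `A ⊗ 1 + 1 ⊗ Ā - Σ C ⊗ C̄`). No new definitions.
-/

-- the mandated namespace `Summit.<Summit>.<Problem>.Theorems` repeats `HubbardSuperconductivity`
-- (single-problem summit, D-0017), which the `dupNamespace` linter flags on every declaration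
set_option linter.dupNamespace false

namespace Summit.HubbardSuperconductivity.HubbardSuperconductivity.Theorems.JosephsonMirror

open Matrix Literature.MathematicalPhysics.QuantumLattice
open scoped Kronecker ComplexOrder

variable {ι : Type*} [Fintype ι] [DecidableEq ι]

omit [DecidableEq ι] in
/-- Lieb's packaging: `(X ⊗ Y) ψ_Z = ψ_{X Z Yᵀ}`. Lieb, PRL 62 (1989) 1201, eq. (4). [folklore] -/
theorem kronecker_mulVec_vec (X Y Z : Matrix ι ι ℂ) :
    (X ⊗ₖ Y) *ᵥ (fun p : ι × ι => Z p.1 p.2) = fun p : ι × ι => (X * Z * Yᵀ) p.1 p.2 := by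
  funext p
  simp only [mulVec, dotProduct, Fintype.sum_prod_type, kroneckerMap_apply, mul_apply,
    transpose_apply, Finset.sum_mul]
  rw [Finset.sum_comm]
  refine Finset.sum_congr rfl fun t _ => Finset.sum_congr rfl fun s _ => ?_
  ring

omit [DecidableEq ι] in
/-- The inner product of packaged vectors is the Hilbert–Schmidt inner product
`⟨ψ_Z, ψ_{Z'}⟩ = tr (Zᴴ Z')`. Lieb, PRL 62 (1989) 1201 (`⟨ψ|ψ⟩ = Tr W²`). [folklore] -/
theorem star_vec_dotProduct_vec (Z Z' : Matrix ι ι ℂ) :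
    star (fun p : ι × ι => Z p.1 p.2) ⬝ᵥ (fun p : ι × ι => Z' p.1 p.2) = hsInner Z Z' := by
  rw [hsInner_apply, dotProduct, Fintype.sum_prod_type]
  rfl

omit [Fintype ι] [DecidableEq ι] in
/-- Every two-layer vector is packaged by its matrix of coefficients. [folklore] -/
theorem vec_of_eq (u : ι × ι → ℂ) : (fun p : ι × ι => (Matrix.of fun s t => u (s, t)) p.1 p.2) = u := by
  funext p
  rfl

/-- The window double acts on packaged vectors as the matrix map
`𝓛 Z = A Z + Z A - J (D Z Dᴴ + Dᴴ Z D)`. Lieb, PRL 62 (1989) 1201, eq. (4); Dyson–Lieb–Simon,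
J. Stat. Phys. 18 (1978) 335. [folklore] -/
theorem windowDouble_mulVec_vec (A D Z : Matrix ι ι ℂ) (J : ℝ) :
    (A ⊗ₖ (1 : Matrix ι ι ℂ) + (1 : Matrix ι ι ℂ) ⊗ₖ Aᵀ - (J : ℂ) • (D ⊗ₖ Dᴴᵀ + Dᴴ ⊗ₖ Dᵀ)) *ᵥ
        (fun p : ι × ι => Z p.1 p.2) =
      fun p : ι × ι => (A * Z + Z * A - (J : ℂ) • (D * Z * Dᴴ + Dᴴ * Z * D)) p.1 p.2 := by
  simp only [sub_mulVec, add_mulVec, smul_mulVec, kronecker_mulVec_vec, transpose_one,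
    Matrix.mul_one, transpose_transpose, Matrix.one_mul]
  funext p
  simp only [Pi.sub_apply, Pi.add_apply, Pi.smul_apply, Matrix.sub_apply, Matrix.add_apply,
    Matrix.smul_apply]

omit [Fintype ι] [DecidableEq ι] in
/-- Mirror covariance of the matrix map: `(𝓛 Z)ᴴ = 𝓛 Zᴴ` for Hermitian `A` and real `J`
(any `D`). Lieb, PRL 62 (1989) 1201, proof of Theorem 1. [folklore] -/
theorem windowOp_conjTranspose [Fintype ι] {A : Matrix ι ι ℂ} (hA : A.IsHermitian)
    (D Z : Matrix ι ι ℂ) (J : ℝ) :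
    (A * Z + Z * A - (J : ℂ) • (D * Z * Dᴴ + Dᴴ * Z * D))ᴴ =
      A * Zᴴ + Zᴴ * A - (J : ℂ) • (D * Zᴴ * Dᴴ + Dᴴ * Zᴴ * D) := by
  simp only [conjTranspose_sub, conjTranspose_add, conjTranspose_smul, conjTranspose_mul,
    conjTranspose_conjTranspose, hA.eq, Complex.star_def, Complex.conj_ofReal, Matrix.mul_assoc]
  abel

omit [DecidableEq ι] in
/-- The energy of a packaged vector: `⟨ψ_Z, H(J) ψ_Z⟩ = ⟨Z, 𝓛 Z⟩_HS`. [folklore] -/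
theorem star_vec_dotProduct_windowDouble_mulVec_vec [DecidableEq ι] (A D Z : Matrix ι ι ℂ) (J : ℝ) :
    star (fun p : ι × ι => Z p.1 p.2) ⬝ᵥ
        (A ⊗ₖ (1 : Matrix ι ι ℂ) + (1 : Matrix ι ι ℂ) ⊗ₖ Aᵀ - (J : ℂ) • (D ⊗ₖ Dᴴᵀ + Dᴴ ⊗ₖ Dᵀ)) *ᵥ
          (fun p : ι × ι => Z p.1 p.2) =
      hsInner Z (A * Z + Z * A - (J : ℂ) • (D * Z * Dᴴ + Dᴴ * Z * D)) := by
  rw [windowDouble_mulVec_vec, star_vec_dotProduct_vec]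

/-- The mirror `θ ψ (s,t) = conj ψ(t,s)` (`ψ_W ↦ ψ_{Wᴴ}`) commutes with the window double, for
ANY Hermitian `A` and ANY `D`. Lieb, PRL 62 (1989) 1201, proof of Theorem 1; Dyson–Lieb–Simon,
J. Stat. Phys. 18 (1978) 335. [folklore] -/
theorem windowDouble_mulVec_mirror {A : Matrix ι ι ℂ} (hA : A.IsHermitian) (D : Matrix ι ι ℂ)
    (J : ℝ) (x : ι × ι → ℂ) :
    (A ⊗ₖ (1 : Matrix ι ι ℂ) + (1 : Matrix ι ι ℂ) ⊗ₖ Aᵀ - (J : ℂ) • (D ⊗ₖ Dᴴᵀ + Dᴴ ⊗ₖ Dᵀ)) *ᵥ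
        (fun p : ι × ι => star (x (p.2, p.1))) =
      fun p : ι × ι =>
        star (((A ⊗ₖ (1 : Matrix ι ι ℂ) + (1 : Matrix ι ι ℂ) ⊗ₖ Aᵀ -
          (J : ℂ) • (D ⊗ₖ Dᴴᵀ + Dᴴ ⊗ₖ Dᵀ)) *ᵥ x) (p.2, p.1)) := by
  have h1 := windowDouble_mulVec_vec A D (Matrix.of fun s t => x (s, t))ᴴ J
  have h2 := windowDouble_mulVec_vec A D (Matrix.of fun s t => x (s, t)) J
  rw [vec_of_eq] at h2
  rw [h2]
  change (A ⊗ₖ (1 : Matrix ι ι ℂ) + (1 : Matrix ι ι ℂ) ⊗ₖ Aᵀ - (J : ℂ) • (D ⊗ₖ Dᴴᵀ + Dᴴ ⊗ₖ Dᵀ)) *ᵥ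
      (fun p : ι × ι => ((Matrix.of fun s t => x (s, t))ᴴ) p.1 p.2) = _
  rw [h1, ← windowOp_conjTranspose hA]
  rfl

/-- **A Hermitian ground matrix on a mirror-symmetric window.** Let `A` be Hermitian, `D`
arbitrary, `J` real, and let `S` be the coordinate subspace of two-layer vectors supported on a
nonempty SYMMETRIC set `good` of pairs. Then there is a nonzero HERMITIAN `W`, supported on
`good`, whose packaged vector `ψ_W` has energy `⟨W, 𝓛 W⟩ = E ‖W‖²` with `E = minEnergyOn (H(J)) S`
the window energy. Proof: the compression `P H(J) P` to the window is Hermitian and leaves the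
coordinate subspace invariant, so it has a ground vector `ψ ∈ S` (`sector_groundState`); by mirror
covariance `θ ψ` is one too, hence so are `ψ + θ ψ` and `i (ψ - θ ψ)` (both mirror-invariant, i.e.
with Hermitian matrix), one of which is nonzero. Lieb, PRL 62 (1989) 1201, proof of Theorem 1.
[folklore] -/
theorem exists_hermitian_window_groundMatrix (A D : Matrix ι ι ℂ) (hA : A.IsHermitian) (J : ℝ)
    (good : ι × ι → Prop) (hsymm : ∀ s t, good (s, t) → good (t, s)) (hne : ∃ p, good p)
    (S : Submodule ℂ (ι × ι → ℂ)) (hS : ∀ ψ, ψ ∈ S ↔ ∀ p, ¬ good p → ψ p = 0) :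
    ∃ W : Matrix ι ι ℂ, Wᴴ = W ∧ W ≠ 0 ∧ (∀ s t, ¬ good (s, t) → W s t = 0) ∧
      (hsInner W (A * W + W * A - (J : ℂ) • (D * W * Dᴴ + Dᴴ * W * D))).re =
        (A ⊗ₖ (1 : Matrix ι ι ℂ) + (1 : Matrix ι ι ℂ) ⊗ₖ Aᵀ -
            (J : ℂ) • (D ⊗ₖ Dᴴᵀ + Dᴴ ⊗ₖ Dᵀ)).minEnergyOn S * (hsInner W W).re := by
  classical
  set M : Matrix (ι × ι) (ι × ι) ℂ := A ⊗ₖ (1 : Matrix ι ι ℂ) + (1 : Matrix ι ι ℂ) ⊗ₖ Aᵀ -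
    (J : ℂ) • (D ⊗ₖ Dᴴᵀ + Dᴴ ⊗ₖ Dᵀ) with hM
  have hMh : M.IsHermitian := isHermitian_windowDouble hA D J
  -- the mirror
  have hMθ : ∀ x : ι × ι → ℂ, M *ᵥ (fun p : ι × ι => star (x (p.2, p.1))) =
      fun p : ι × ι => star ((M *ᵥ x) (p.2, p.1)) := fun x => by
    rw [hM]
    exact windowDouble_mulVec_mirror hA D J x
  have hgood_swap : ∀ p : ι × ι, good (p.2, p.1) ↔ good p := fun p =>
    ⟨fun h => hsymm _ _ h, fun h => hsymm _ _ h⟩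
  -- the window projection and the compression
  set Pm : Matrix (ι × ι) (ι × ι) ℂ := diagonal fun p => if good p then 1 else 0 with hPm
  have hPmh : Pm.IsHermitian := by
    rw [hPm, Matrix.IsHermitian, diagonal_conjTranspose]
    congr 1
    funext p
    simp only [Pi.star_apply]
    split_ifs <;> simp
  have hPmapply : ∀ (x : ι × ι → ℂ) (p : ι × ι),
      (Pm *ᵥ x) p = (if good p then 1 else 0) * x p := fun x p => by
    rw [hPm, mulVec_diagonal]
  have hPmθ : ∀ x : ι × ι → ℂ, Pm *ᵥ (fun p : ι × ι => star (x (p.2, p.1))) =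
      fun p : ι × ι => star ((Pm *ᵥ x) (p.2, p.1)) := fun x => by
    funext p
    rw [hPmapply, hPmapply]
    have hg : (good (p.2, p.1)) ↔ good p := hgood_swap p
    by_cases hp : good p
    · rw [if_pos hp, if_pos (hg.2 hp), one_mul, one_mul]
    · rw [if_neg hp, if_neg (fun h => hp (hg.1 h)), zero_mul, zero_mul, star_zero]
  set B : Matrix (ι × ι) (ι × ι) ℂ := Pm * M * Pm with hB
  have hBh : B.IsHermitian := by
    rw [hB, Matrix.IsHermitian, conjTranspose_mul, conjTranspose_mul, hPmh.eq, hMh.eq,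
      Matrix.mul_assoc]
  have hBmul : ∀ x : ι × ι → ℂ, B *ᵥ x = Pm *ᵥ (M *ᵥ (Pm *ᵥ x)) := fun x => by
    rw [hB, ← mulVec_mulVec, ← mulVec_mulVec]
  have hBθ : ∀ x : ι × ι → ℂ, B *ᵥ (fun p : ι × ι => star (x (p.2, p.1))) =
      fun p : ι × ι => star ((B *ᵥ x) (p.2, p.1)) := fun x => by
    rw [hBmul, hPmθ, hMθ, hPmθ, hBmul]
  have hinv : ∀ p q, ¬ good p → good q → B p q = 0 := by
    intro p q hp _
    rw [hB, hPm, mul_diagonal, diagonal_mul, if_neg hp, zero_mul, zero_mul]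
  have hPmv : ∀ u ∈ S, Pm *ᵥ u = u := by
    intro u hu
    funext p
    rw [hPmapply]
    by_cases hp : good p
    · rw [if_pos hp, one_mul]
    · rw [if_neg hp, zero_mul, (hS u).1 hu p hp]
  have hBu : ∀ u ∈ S, star u ⬝ᵥ B *ᵥ u = star u ⬝ᵥ M *ᵥ u := by
    intro u hu
    have hst : star u ᵥ* Pm = star (Pm *ᵥ u) := by rw [star_mulVec, hPmh.eq]
    rw [hBmul, hPmv u hu, dotProduct_mulVec, hst, hPmv u hu]
  have hminE : B.minEnergyOn S = M.minEnergyOn S := by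
    unfold Matrix.minEnergyOn
    congr 1
    ext E
    constructor
    · rintro ⟨ψ, hψ, h1, rfl⟩
      exact ⟨ψ, hψ, h1, by rw [hBu ψ hψ]⟩
    · rintro ⟨ψ, hψ, h1, rfl⟩
      exact ⟨ψ, hψ, h1, by rw [hBu ψ hψ]⟩
  -- a ground vector of the compression
  obtain ⟨p₀, hp₀⟩ := hne
  obtain ⟨⟨v, hvS, hv0, hBv⟩, -⟩ := sector_groundState B hBh good ⟨p₀, hp₀⟩ hinv S hS
  set E : ℝ := B.minEnergyOn S with hE
  -- mirror-invariant ground vectors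
  have hθS : ∀ x ∈ S, (fun p : ι × ι => star (x (p.2, p.1))) ∈ S := by
    intro x hx
    refine (hS _).2 fun p hp => ?_
    have : x (p.2, p.1) = 0 := (hS x).1 hx _ fun h => hp ((hgood_swap p).1 h)
    simp only [this, star_zero]
  set u : ι × ι → ℂ := fun p => star (v (p.2, p.1)) with hu
  have huS : u ∈ S := hθS v hvS
  have hBu' : B *ᵥ u = (E : ℂ) • u := by
    rw [hu, hBθ, hBv]
    funext p
    simp only [Pi.smul_apply, smul_eq_mul, star_mul', Complex.star_def, Complex.conj_ofReal]
  set w₁ : ι × ι → ℂ := v + u with hw₁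
  set w₂ : ι × ι → ℂ := Complex.I • (v - u) with hw₂
  have hw₁S : w₁ ∈ S := S.add_mem hvS huS
  have hw₂S : w₂ ∈ S := S.smul_mem _ (S.sub_mem hvS huS)
  have hBw₁ : B *ᵥ w₁ = (E : ℂ) • w₁ := by rw [hw₁, mulVec_add, hBv, hBu', smul_add]
  have hBw₂ : B *ᵥ w₂ = (E : ℂ) • w₂ := by
    rw [hw₂, mulVec_smul, mulVec_sub, hBv, hBu', ← smul_sub, smul_comm]
  have hθw₁ : (fun p : ι × ι => star (w₁ (p.2, p.1))) = w₁ := by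
    funext p
    obtain ⟨s, t⟩ := p
    simp only [hw₁, hu, Pi.add_apply, star_add, star_star]
    exact add_comm _ _
  have hθw₂ : (fun p : ι × ι => star (w₂ (p.2, p.1))) = w₂ := by
    funext p
    obtain ⟨s, t⟩ := p
    simp only [hw₂, hu, Pi.smul_apply, Pi.sub_apply, smul_eq_mul, star_mul', star_sub,
      Complex.star_def, Complex.conj_conj, Complex.conj_I]
    ring
  -- one of them is nonzero
  obtain ⟨w, hwS, hw0, hBw, hθw⟩ : ∃ w ∈ S, w ≠ 0 ∧ B *ᵥ w = (E : ℂ) • w ∧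
      (fun p : ι × ι => star (w (p.2, p.1))) = w := by
    by_cases h1 : w₁ = 0
    · refine ⟨w₂, hw₂S, fun h2 => hv0 ?_, hBw₂, hθw₂⟩
      have hvu : v - u = 0 := by
        rw [hw₂, smul_eq_zero] at h2
        exact h2.resolve_left Complex.I_ne_zero
      have h2v : (2 : ℂ) • v = 0 := by
        rw [two_smul]
        calc v + v = (v + u) + (v - u) := by abel
          _ = 0 := by rw [← hw₁, h1, hvu, add_zero]
      rw [smul_eq_zero] at h2v
      exact h2v.resolve_left two_ne_zero
    · exact ⟨w₁, hw₁S, h1, hBw₁, hθw₁⟩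
  -- its matrix
  refine ⟨Matrix.of fun s t => w (s, t), ?_, ?_, ?_, ?_⟩
  · ext s t
    have := congrFun hθw (s, t)
    simpa using this
  · intro h0
    apply hw0
    funext p
    have := congrFun (congrFun h0 p.1) p.2
    simpa using this
  · intro s t hst
    exact (hS w).1 hwS (s, t) hst
  · rw [← star_vec_dotProduct_windowDouble_mulVec_vec, ← star_vec_dotProduct_vec, vec_of_eq, ← hM,
      ← hBu w hwS, hBw, dotProduct_smul, smul_eq_mul, Complex.re_ofReal_mul, hminE]

end Summit.HubbardSuperconductivity.HubbardSuperconductivity.Theorems.JosephsonMirror
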